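/-
Copyright: the b2b-balaban T⁴-continuum CRUX team, row NE7b OWNER lineage `t4-ne7b-p1` (gen 146). Project licence.
-/
import Summits.QuantumFields.BalabanUV.T4Continuum.Spine.NE7b.SupWeightedTwoPointMastersTwo
import Summits.QuantumFields.BalabanUV.T4Continuum.Spine.NE7b.SupWeightedFivePointToolsTwo
import Summits.QuantumFields.BalabanUV.T4Continuum.Spine.NE7b.SupFivePointGreedyRowSum

/-!
# THE WEIGHTED FIFTH-ORDER SLOT LETTER, SLOT ONE (`x` fixed), PART 3 OF 8 (SCOPING-d17 §F, F13–F17; file (694)).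
# The interpolated entry majorant `M₅′` of (687) (52 terms, no support indicator, product decay) summed over its four free indices against
# the full-graph weight `W = Π_{10 pairs}ϑ` with `x` fixed — the OUTPUT slot letter of the weighted class at order five — from weighted INPUT
# letters only: the full-graph `ϑ₂`-weighted `K5` letter of this role, the `σ`-profile letters of the `Hk`∕`K3`∕`K4`∕`K5` families (masses and
# columns; discharged from intrinsic letters as in (659)∕(666)), the `ϑ₂`-weighted `Hk`∕`K3` letters, and three geometry letters (`G = sup
# Σϑ⁶∕√ρ`, `Θ8 = sup Σϑ⁸∕ϑ₂`, `S2 = sup Σϑ²∕r₁`).  ROUTING: every pair of the five indices is carried along the term's tree (loads `≤ 6` on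
# `ρ`-edges and the crossing edge — `ϑ⁶ ≤ σσ` —, `≤ 4` on Hessian∕internal edges — `ϑ⁴ ≤ ϑ₂` —, `≤ 2` on `r₁`-star edges; non-star pairs of the
# product-decay terms absorbed by `ϑ ≤ r₁`), then summed leaf-first ((689)∕(691)).  NO support letter, NO finite-range hypothesis
# (row NE7b, node U5c; (653), (656), (687), (689), (691) BY NAME; [folklore]).

Cell `pub-balaban`, sub-cell `t4`, spine estimate NE7b (`T4WeightBudget.RelWeightBound`; the cell's OWN estimate — NOT PRINTED in
[Bałaban 1983–89], NOT PROVED).  Crux-route work under `Spine/NE7b/` by the row OWNER (`t4-ne7b-p1` gen 146, file (694)) under FREEZE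
(0)'s crux-prover clause; NOTHING of Bałaban's is named as a Lean object, valued or asserted; no `T4Continuum/Support` leaf typed; no
`def`, no notation (`M₅′`'s terms WRITTEN OUT as printed by (687)); zero `sorry`.  Imports (BY NAME): (656), (691) ((689), (653), (649)
through them), (538) (`sum4_rot3∕4`).

WHAT IS PROVED ([folklore]): **`output_k5ϑ_x_part3`**; toy.

HONEST (what this is NOT).  One slot (part) of five; hypotheses = the weighted-class letters of SCOPING-d17 §D∕§F at order five (rates `ϑ⁴ ≤ ϑ₂`,
`ϑ⁶ ≤ σσ`, `ϑ ≤ r₁`, `Σϑ⁸∕ϑ₂, Σϑ⁶∕√ρ, Σϑ²∕r₁ < ∞`); the `K5` profile discharges and the packaging are later files; scalar skeleton ((A3),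
NC-NE7b-α UNRULED); nothing of Bałaban's asserted.  BY-NAME EFFECT ON THE WALL: NONE.  NE7b NOT PRINTED ∕ NOT PROVED; spine PROVED 0∕9; rung
(B)+1 — the programme's measures remain FINITE-torus statements; NOT the mass gap, NOT Clay.  HONEST DEPENDENCY: continuum YM on T⁴ ⇐ BetaPertH
∧ nine spine estimates (0∕9 proved); BetaPertH ⇐ (D1) ∧ (D4) ∧ CAP+tail; G-an2-4 gates asym, D1 and NE2∕3∕4.
-/

set_option autoImplicit false

noncomputable section

namespace Summit.QuantumFields.BalabanUV.T4Continuum.NE7b.SupWeightedFifthOrderLettersOnePart3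

open Finset Real
open scoped BigOperators
open SupWeightedSlotTools (sum_sqrt_mul_le_letters)
open SupWeightedTwoPointMasters (weighted_two_point_family_le weighted_two_point_family_le')
open SupWeightedTwoPointMastersTwo (weighted_two_point_two_families_le weighted_two_point_two_families_le')
open SupWeightedFivePointTools
open SupWeightedFivePointToolsTwo (rmono smono tmono pmono geom2 sum2_sqrt_mul_le_letters' absorb_le_one mul_le_one_of sqrt_split3
  sqrt_split4 sqrt_split_tree)
open SupFivePointGreedyRowSum (sum4_rot3 sum4_rot4)

variable {ι κ : Type} [Fintype ι] [Fintype κ]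

variable {Hk : ι → ι → ℝ} {K3 : ι → ι → ι → ℝ} {K4 : ι → ι → ι → ι → ℝ} {K5 : ι → ι → ι → ι → ι → ℝ} {A : Matrix ι κ ℝ} {D : κ → κ → ℝ}
  {ϑ ϑ₂ ρ r₁ : ι → ι → ℝ} {σ : ι → κ → ℝ} {θ : κ → κ → ℝ}
  {κ₂ γop lam lamA C3k C3h C4 C5 dθ dθ' αθ αθc αg1m αg2m αg1c αk4m1 αk4m2 αk4m3 αk4c αk5m1 αk5m2 αk5m3 αk5m4 αk5c hrϑ hcϑ k3rϑ k3mϑ k3cϑ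
    k5ϑ1 k5ϑ2 k5ϑ3 k5ϑ4 k5ϑ5 G Θ8 S2 : ℝ}

set_option maxHeartbeats 1600000 in
/-- **WEIGHTED FIFTH-ORDER SLOT LETTER, `x` FIXED, PART 3 OF 8**: terms `17, 18, 19, 20, 21, 22, 23, 24` of `M₅′` ((687)) summed over
the four free indices against the full-graph weight `Π_{10 pairs}ϑ`. [folklore] -/
theorem output_k5ϑ_x_part3 (hK40 : ∀ a b c u, 0 ≤ K4 a b c u) (hK30 : ∀ a b u, 0 ≤ K3 a b u) (hHk0 : ∀ v u, 0 ≤ Hk v u) (hD : ∀ x y, 0 ≤ D x y)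
    (hlamA1 : lamA < 1)
    (hθnn : ∀ z w, 0 ≤ θ z w) (hDθr : ∀ z', ∑ w, D z' w * θ z' w ≤ dθ) (hdθ : 0 ≤ dθ) (hDθc : ∀ w, ∑ z', D z' w * θ z' w ≤ dθ')
    (hdθ' : 0 ≤ dθ') (hσ0 : ∀ x w, 0 ≤ σ x w) (hσθ : ∀ x z' w, σ x w ≤ σ x z' * θ z' w) (hϑ1 : ∀ x y, 1 ≤ ϑ x y)
    (hϑsymm : ∀ x y, ϑ x y = ϑ y x) (hϑmul : ∀ x y z, ϑ x z ≤ ϑ x y * ϑ y z) (hϑ4 : ∀ x y, ϑ x y ^ 4 ≤ ϑ₂ x y)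
    (hϑσ6 : ∀ x y w, ϑ x y ^ 6 ≤ σ x w * σ y w) (hρ0 : ∀ x y, 0 < ρ x y) (hG : ∀ a, ∑ b, ϑ a b ^ 6 / Real.sqrt (ρ a b) ≤ G)
    (hΘ : ∀ a, ∑ b, (ϑ a b ^ 4) ^ 2 / ϑ₂ a b ≤ Θ8) (hhc : ∀ a, ∑ b, ϑ₂ a b * Hk b a ≤ hcϑ)
    (hk3c : ∀ v, ∑ y, ∑ z, K3 y z v * (ϑ₂ v y * ϑ₂ v z * ϑ₂ y z) ≤ k3cϑ)
    (hg1c : ∀ z', ∑ x, ∑ y, (∑ u, |A u z'| * K3 x y u) * (σ x z' * ϑ₂ x y) ≤ αg1c) (hαg1c : 0 ≤ αg1c)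
    (hk4m1 : ∀ s, ∑ p, ∑ q, (ϑ₂ s p * ϑ₂ s q * ϑ₂ p q) * ∑ z', (∑ u, |A u z'| * K4 s p q u) * σ s z' ≤ αk4m1)
    (x : ι) :
    ∑ y, ∑ z, ∑ t, ∑ s,
        ((∑ w, (∑ z', D z' w * ∑ u, |A u z'| * K4 x y t u) * (∑ z', D z' w * ∑ u, |A u z'| * K3 z s u) / (1 - lamA) : ℝ) +
          (∑ w, (∑ z', D z' w * ∑ u, |A u z'| * K4 x z s u) * (∑ z', D z' w * ∑ u, |A u z'| * K3 y t u) / (1 - lamA) : ℝ) +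
          (Real.sqrt (4 * Hk t y * Hk s z * Real.sqrt (Real.sqrt (5 * (κ₂ ^ 4 * γop ^ 2) / (1 - lam * γop) ^ 2)) * C3h) / Real.sqrt
            (ρ x y * ρ x z) : ℝ) + (∑ w, (∑ z', D z' w * ∑ u, |A u z'| * K4 x y s u) * (∑ z', D z' w * ∑ u, |A u z'| * K3 z t u) / (1 - lamA) : ℝ)
          + (∑ w, (∑ z', D z' w * ∑ u, |A u z'| * K4 x z t u) * (∑ z', D z' w * ∑ u, |A u z'| * K3 y s u) / (1 - lamA) : ℝ) +
          (Real.sqrt (4 * Hk s y * Hk t z * Real.sqrt (Real.sqrt (5 * (κ₂ ^ 4 * γop ^ 2) / (1 - lam * γop) ^ 2)) * C3h) / Real.sqrt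
            (ρ x y * ρ x z) : ℝ) +
          (Real.sqrt (2 * K3 y z x * Real.sqrt (5 * (κ₂ ^ 4 * γop ^ 2) / (1 - lam * γop) ^ 2) * C3k) / Real.sqrt (ρ x t * ρ x s) : ℝ) +
          (Real.sqrt (4 * Hk t x * Hk z y * Real.sqrt (Real.sqrt (5 * (κ₂ ^ 4 * γop ^ 2) / (1 - lam * γop) ^ 2)) * C3h) / Real.sqrt
            (ρ x y * ρ x s) : ℝ)) * (ϑ x y * ϑ x z * ϑ x t * ϑ x s * ϑ y z * ϑ y t * ϑ y s * ϑ z t * ϑ z s * ϑ t s) ≤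
      dθ * αk4m1 * (dθ' * αg1c) / (1 - lamA) + dθ * αk4m1 * (dθ' * αg1c) / (1 - lamA) + Real.sqrt
          (4 * Real.sqrt (Real.sqrt (5 * (κ₂ ^ 4 * γop ^ 2) / (1 - lam * γop) ^ 2)) * C3h) *
          (G * (G * (Real.sqrt (hcϑ * Θ8) * Real.sqrt (hcϑ * Θ8)))) + dθ * αk4m1 * (dθ' * αg1c) / (1 - lamA) + dθ * αk4m1 * (dθ' * αg1c) /
          (1 - lamA) + Real.sqrt (4 * Real.sqrt (Real.sqrt (5 * (κ₂ ^ 4 * γop ^ 2) / (1 - lam * γop) ^ 2)) * C3h) *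
          (G * (G * (Real.sqrt (hcϑ * Θ8) * Real.sqrt (hcϑ * Θ8)))) + Real.sqrt
          (2 * Real.sqrt (5 * (κ₂ ^ 4 * γop ^ 2) / (1 - lam * γop) ^ 2) * C3k) * (G * (G * Real.sqrt (k3cϑ * (Θ8 * Θ8)))) + Real.sqrt
          (4 * Real.sqrt (Real.sqrt (5 * (κ₂ ^ 4 * γop ^ 2) / (1 - lam * γop) ^ 2)) * C3h) *
          (G * (Real.sqrt (hcϑ * Θ8) * (G * Real.sqrt (hcϑ * Θ8)))) := by
  generalize Real.sqrt (5 * (κ₂ ^ 4 * γop ^ 2) / (1 - lam * γop) ^ 2) = sV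
  have hl : 0 < 1 - lamA := by linarith
  have h0 : ∀ a b, 0 ≤ ϑ a b := fun a b => zero_le_one.trans (hϑ1 a b)
  have h1 : ∀ a b, 1 ≤ ϑ a b := hϑ1
  have hϑ2k : ∀ a b (k : ℕ), k ≤ 4 → ϑ a b ^ k ≤ ϑ₂ a b := fun a b k hk => (pow_le_pow_right₀ (hϑ1 a b) hk).trans (hϑ4 a b)
  have hϑ₂0 : ∀ a b, 0 ≤ ϑ₂ a b := fun a b => (pow_nonneg (h0 a b) 4).trans (hϑ4 a b)
  have hϑ₂pos : ∀ a b, 0 < ϑ₂ a b := fun a b => lt_of_lt_of_le (pow_pos (lt_of_lt_of_le one_pos (hϑ1 a b)) 4) (hϑ4 a b)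
  have hm00 : ∀ a c b, ϑ a b ≤ ϑ a c * ϑ c b := fun a c b => hϑmul a c b
  have hm10 : ∀ a c b, ϑ a b ≤ ϑ c a * ϑ c b := fun a c b => by rw [hϑsymm c a]; exact hϑmul a c b
  have hϑsq : ∀ a b (k : ℕ), k * 2 ≤ 4 → (ϑ a b ^ k) ^ 2 ≤ ϑ₂ a b := fun a b k hk => by rw [← pow_mul]; exact hϑ2k a b (k * 2) hk
  have tnn : ∀ a b, 0 ≤ (ϑ a b ^ 4) ^ 2 / ϑ₂ a b := fun a b => div_nonneg (pow_nonneg (pow_nonneg (h0 a b) 4) 2) (hϑ₂0 a b)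
  have hT0 : 0 ≤ Θ8 := le_trans (Finset.sum_nonneg fun b _ => tnn x b) (hΘ x)
  have hG0 : 0 ≤ G := le_trans (Finset.sum_nonneg fun b _ => div_nonneg (pow_nonneg (h0 _ _) 6) (Real.sqrt_nonneg _)) (hG x)
  have hxI : ∀ {c S T I : ℝ}, c ≤ S * T → 0 ≤ I → c * I ≤ S * (T * I) := fun h hI => by
    rw [← mul_assoc]; exact mul_le_mul_of_nonneg_right h hI
  have hσI : ∀ {S S₁ T I : ℝ}, S ≤ S₁ * T → 0 ≤ I → S * I ≤ S₁ * I * T := fun h hI => by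
    rw [mul_right_comm]; exact mul_le_mul_of_nonneg_right h hI
  have hI3 : ∀ a b c, 0 ≤ ϑ₂ a b * ϑ₂ a c * ϑ₂ b c := fun a b c => mul_nonneg (mul_nonneg (hϑ₂0 a b) (hϑ₂0 a c)) (hϑ₂0 b c)
  have hF3 : ∀ a b z', 0 ≤ ∑ u, |A u z'| * K3 a b u := fun a b z' => Finset.sum_nonneg fun u _ => mul_nonneg (abs_nonneg _) (hK30 a b u)
  have hF4 : ∀ a b c z', 0 ≤ ∑ u, |A u z'| * K4 a b c u := fun a b c z' => Finset.sum_nonneg fun u _ => mul_nonneg (abs_nonneg _) (hK40 a b c u)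
  have hE : ∀ {F G : κ → ℝ}, (∀ z', 0 ≤ F z') → (∀ z', 0 ≤ G z') →
      0 ≤ ∑ w, (∑ z', D z' w * F z') * (∑ z', D z' w * G z') / (1 - lamA) := fun hF hG => Finset.sum_nonneg fun w _ =>
    div_nonneg
        (mul_nonneg (Finset.sum_nonneg fun z' _ => mul_nonneg (hD z' w) (hF z')) (Finset.sum_nonneg fun z' _ => mul_nonneg (hD z' w) (hG z')))
        hl.le
  have tm17 : ∑ y, ∑ z, ∑ t, ∑ s,
      ((∑ w, (∑ z', D z' w * ∑ u, |A u z'| * K4 x y t u) * (∑ z', D z' w * ∑ u, |A u z'| * K3 z s u) / (1 - lamA) : ℝ)) *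
      (ϑ x y * ϑ x z * ϑ x t * ϑ x s * ϑ y z * ϑ y t * ϑ y s * ϑ z t * ϑ z s * ϑ t s) ≤ dθ * αk4m1 * (dθ' * αg1c) / (1 - lamA) := by
    have hw : ∀ y z t s : ι, ϑ x y * ϑ x z * ϑ x t * ϑ x s * ϑ y z * ϑ y t * ϑ y s * ϑ z t * ϑ z s * ϑ t s ≤ ϑ₂ x y * ϑ₂ x t * ϑ₂ y t *
        (ϑ x z ^ 6 * (ϑ₂ z s)) := fun y z t s =>
      ((prod10_le le_rfl le_rfl le_rfl ((hm00 x z s)) ((hm10 y x z)) le_rfl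
              (((hm10 y x s).trans (mul_le_mul_of_nonneg_left (hm00 x z s) (h0 _ _)))) ((hm10 z x t)) le_rfl
              (((hm10 t x s).trans (mul_le_mul_of_nonneg_left (hm00 x z s) (h0 _ _)))) (h0 _ _) (h0 _ _) (h0 _ _) (h0 _ _) (h0 _ _) (h0 _ _)
              (h0 _ _) (h0 _ _) (h0 _ _) (h0 _ _)).trans_eq (by ring)).trans
          (mul_le_mul
            (mul_le_mul (mul_le_mul (hϑ2k x y 3 (by norm_num)) (hϑ2k x t 3 (by norm_num)) (pow_nonneg (h0 _ _) _) (hϑ₂0 _ _))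
              (hϑ2k y t 1 (by norm_num)) (pow_nonneg (h0 _ _) _) (mul_nonneg (hϑ₂0 _ _) (hϑ₂0 _ _)))
            (mul_le_mul (pow_le_pow_right₀ (h1 x z) (by norm_num : 6 ≤ 6)) (hϑ2k z s 4 (by norm_num)) (pow_nonneg (h0 z s) 4)
              (pow_nonneg (h0 _ _) _)) (mul_nonneg (pow_nonneg (h0 _ _) _) (pow_nonneg (h0 z s) 4))
            (mul_nonneg (mul_nonneg (hϑ₂0 _ _) (hϑ₂0 _ _)) (hϑ₂0 _ _)))
    have h := weighted_two_point_two_families_le' (R := ι × ι) (S := ι × ι) (αm := αk4m1) (g := fun r z' => ∑ u, |A u z'| * K4 x r.1 r.2 u)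
        (α := fun r => ϑ₂ x r.1 * ϑ₂ x r.2 * ϑ₂ r.1 r.2) (b := fun q z' => ∑ u, |A u z'| * K3 q.1 q.2 u) (σ := fun w => σ x w)
        (σ₁ := fun z' => σ x z') (σ' := fun q w => σ q.1 w * (ϑ₂ q.1 q.2)) (σ'₁ := fun q z' => σ q.1 z' * (ϑ₂ q.1 q.2))
        (β := fun q => ϑ x q.1 ^ 6 * (ϑ₂ q.1 q.2)) (fun r z' => hF4 x r.1 r.2 z') (fun r => (hI3 x r.1 r.2)) (fun q z' => hF3 q.1 q.2 z') hD hθnn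
        (fun w => hσ0 x w) (fun z' => hσ0 x z') (fun q w => hxI (hϑσ6 x q.1 w) (hϑ₂0 q.1 q.2)) (fun z' w => hσθ x z' w)
        (fun q z' w => hσI (hσθ q.1 z' w) (hϑ₂0 q.1 q.2)) hDθr hdθ hDθc hdθ' (by simpa only [Fintype.sum_prod_type] using hk4m1 x)
        (fun z' => by simpa only [Fintype.sum_prod_type] using hg1c z') hαg1c hlamA1
    simp only [Fintype.sum_prod_type] at h
    refine (sum4_perm_0213 _).trans_le ?_
    refine le_trans ?_ h
    exact Finset.sum_le_sum fun y _ => Finset.sum_le_sum fun t _ => Finset.sum_le_sum fun z _ => Finset.sum_le_sum fun s _ =>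
      mul_le_mul_of_nonneg_left (hw y z t s) (hE (hF4 x y t) (hF3 z s))
  have tm18 : ∑ y, ∑ z, ∑ t, ∑ s,
      ((∑ w, (∑ z', D z' w * ∑ u, |A u z'| * K4 x z s u) * (∑ z', D z' w * ∑ u, |A u z'| * K3 y t u) / (1 - lamA) : ℝ)) *
      (ϑ x y * ϑ x z * ϑ x t * ϑ x s * ϑ y z * ϑ y t * ϑ y s * ϑ z t * ϑ z s * ϑ t s) ≤ dθ * αk4m1 * (dθ' * αg1c) / (1 - lamA) := by
    have hw : ∀ y z t s : ι, ϑ x y * ϑ x z * ϑ x t * ϑ x s * ϑ y z * ϑ y t * ϑ y s * ϑ z t * ϑ z s * ϑ t s ≤ ϑ₂ x z * ϑ₂ x s * ϑ₂ z s *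
        (ϑ x y ^ 6 * (ϑ₂ y t)) := fun y z t s =>
      ((prod10_le le_rfl le_rfl ((hm00 x y t)) le_rfl ((hm10 y x z)) le_rfl ((hm10 y x s))
              (((hm10 z x t).trans (mul_le_mul_of_nonneg_left (hm00 x y t) (h0 _ _)))) le_rfl
              (((hm10 t y s).trans (mul_le_mul_of_nonneg_left (hm10 y x s) (h0 _ _)))) (h0 _ _) (h0 _ _) (h0 _ _) (h0 _ _) (h0 _ _) (h0 _ _)
              (h0 _ _) (h0 _ _) (h0 _ _) (h0 _ _)).trans_eq (by ring)).trans
          (mul_le_mul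
            (mul_le_mul (mul_le_mul (hϑ2k x z 3 (by norm_num)) (hϑ2k x s 3 (by norm_num)) (pow_nonneg (h0 _ _) _) (hϑ₂0 _ _))
              (hϑ2k z s 1 (by norm_num)) (pow_nonneg (h0 _ _) _) (mul_nonneg (hϑ₂0 _ _) (hϑ₂0 _ _)))
            (mul_le_mul (pow_le_pow_right₀ (h1 x y) (by norm_num : 6 ≤ 6)) (hϑ2k y t 4 (by norm_num)) (pow_nonneg (h0 y t) 4)
              (pow_nonneg (h0 _ _) _)) (mul_nonneg (pow_nonneg (h0 _ _) _) (pow_nonneg (h0 y t) 4))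
            (mul_nonneg (mul_nonneg (hϑ₂0 _ _) (hϑ₂0 _ _)) (hϑ₂0 _ _)))
    have h := weighted_two_point_two_families_le' (R := ι × ι) (S := ι × ι) (αm := αk4m1) (g := fun r z' => ∑ u, |A u z'| * K4 x r.1 r.2 u)
        (α := fun r => ϑ₂ x r.1 * ϑ₂ x r.2 * ϑ₂ r.1 r.2) (b := fun q z' => ∑ u, |A u z'| * K3 q.1 q.2 u) (σ := fun w => σ x w)
        (σ₁ := fun z' => σ x z') (σ' := fun q w => σ q.1 w * (ϑ₂ q.1 q.2)) (σ'₁ := fun q z' => σ q.1 z' * (ϑ₂ q.1 q.2))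
        (β := fun q => ϑ x q.1 ^ 6 * (ϑ₂ q.1 q.2)) (fun r z' => hF4 x r.1 r.2 z') (fun r => (hI3 x r.1 r.2)) (fun q z' => hF3 q.1 q.2 z') hD hθnn
        (fun w => hσ0 x w) (fun z' => hσ0 x z') (fun q w => hxI (hϑσ6 x q.1 w) (hϑ₂0 q.1 q.2)) (fun z' w => hσθ x z' w)
        (fun q z' w => hσI (hσθ q.1 z' w) (hϑ₂0 q.1 q.2)) hDθr hdθ hDθc hdθ' (by simpa only [Fintype.sum_prod_type] using hk4m1 x)
        (fun z' => by simpa only [Fintype.sum_prod_type] using hg1c z') hαg1c hlamA1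
    simp only [Fintype.sum_prod_type] at h
    refine (sum4_perm_1302 _).trans_le ?_
    refine le_trans ?_ h
    exact Finset.sum_le_sum fun z _ => Finset.sum_le_sum fun s _ => Finset.sum_le_sum fun y _ => Finset.sum_le_sum fun t _ =>
      mul_le_mul_of_nonneg_left (hw y z t s) (hE (hF4 x z s) (hF3 y t))
  have tm19 : ∑ y, ∑ z, ∑ t, ∑ s, ((Real.sqrt (4 * Hk t y * Hk s z * Real.sqrt (sV) * C3h) / Real.sqrt (ρ x y * ρ x z) : ℝ)) *
      (ϑ x y * ϑ x z * ϑ x t * ϑ x s * ϑ y z * ϑ y t * ϑ y s * ϑ z t * ϑ z s * ϑ t s) ≤ Real.sqrt (4 * Real.sqrt (sV) * C3h) *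
      (G * (G * (Real.sqrt (hcϑ * Θ8) * Real.sqrt (hcϑ * Θ8)))) := by
    have hw : ∀ y z t s : ι, ϑ x y * ϑ x z * ϑ x t * ϑ x s * ϑ y z * ϑ y t * ϑ y s * ϑ z t * ϑ z s * ϑ t s ≤ ϑ x y ^ 6 * ϑ x z ^ 6 * ϑ y t ^ 4 * ϑ
        z s ^ 4 := fun y z t s =>
      (prod10_le le_rfl le_rfl ((hm00 x y t)) ((hm00 x z s)) ((hm10 y x z)) le_rfl
            (((hm10 y x s).trans (mul_le_mul_of_nonneg_left (hm00 x z s) (h0 _ _))))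
            (((hm10 z x t).trans (mul_le_mul_of_nonneg_left (hm00 x y t) (h0 _ _)))) le_rfl
            (((hm10 t y s).trans (mul_le_mul_of_nonneg_left ((hm10 y x s).trans (mul_le_mul_of_nonneg_left (hm00 x z s) (h0 _ _))) (h0 _ _))))
            (h0 _ _) (h0 _ _) (h0 _ _) (h0 _ _) (h0 _ _) (h0 _ _) (h0 _ _) (h0 _ _) (h0 _ _) (h0 _ _)).trans_eq (by ring)
    have hKK0 : 0 ≤ Real.sqrt (4 * Real.sqrt (sV) * C3h) := (Real.sqrt_nonneg _)
    have hpw : ∀ y z t s : ι, ((Real.sqrt (4 * Hk t y * Hk s z * Real.sqrt (sV) * C3h) / Real.sqrt (ρ x y * ρ x z) : ℝ)) *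
        (ϑ x y * ϑ x z * ϑ x t * ϑ x s * ϑ y z * ϑ y t * ϑ y s * ϑ z t * ϑ z s * ϑ t s) ≤ Real.sqrt (4 * Real.sqrt (sV) * C3h) *
        (ϑ x y ^ 6 / Real.sqrt (ρ x y) * ((ϑ x z ^ 6 / Real.sqrt (ρ x z)) * ((Real.sqrt (Hk t y) * ϑ y t ^ 4) * (Real.sqrt (Hk s z) * ϑ z s ^ 4))))
        := fun y z t s =>
      (mul_le_mul_of_nonneg_left (hw y z t s) (div_nonneg (Real.sqrt_nonneg _) (Real.sqrt_nonneg _))).trans_eq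
          (by rw [sqrt_split4 (hHk0 t y) (hHk0 s z), Real.sqrt_mul (hρ0 x y).le]; ring)
    refine le_trans
        (Finset.sum_le_sum fun y _ => Finset.sum_le_sum fun z _ => Finset.sum_le_sum fun t _ => Finset.sum_le_sum fun s _ => hpw y z t s) ?_
    exact sum4_le (K := Real.sqrt (4 * Real.sqrt (sV) * C3h)) (a := fun y => ϑ x y ^ 6 / Real.sqrt (ρ x y))
        (b := fun y z => ϑ x z ^ 6 / Real.sqrt (ρ x z)) (c := fun y z t => Real.sqrt (Hk t y) * ϑ y t ^ 4)
        (d := fun y z t s => Real.sqrt (Hk s z) * ϑ z s ^ 4) hKK0 (fun y => (div_nonneg (pow_nonneg (h0 _ _) _) (Real.sqrt_nonneg _)))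
        (fun y z => (div_nonneg (pow_nonneg (h0 _ _) _) (Real.sqrt_nonneg _)))
        (fun y z t => (mul_nonneg (Real.sqrt_nonneg _) (pow_nonneg (h0 _ _) _))) hG0 (Real.sqrt_nonneg _) (Real.sqrt_nonneg _)
        ((Finset.sum_le_sum fun y _ => rmono (h1 x y) (hρ0 x y) (by norm_num : 6 ≤ 6)).trans (hG x))
        (fun y => ((Finset.sum_le_sum fun z _ => rmono (h1 x z) (hρ0 x z) (by norm_num : 6 ≤ 6)).trans (hG x)))
        (fun y z =>
          (sum_sqrt_mul_le_letters Finset.univ (a := fun t => Hk t y) (c := fun t => ϑ y t ^ 4) (θ := fun t => ϑ₂ y t) (fun t => hHk0 _ _)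
            (fun t => pow_nonneg (h0 _ _) _) (fun t => hϑ₂pos _ _) (hhc y)
            ((Finset.sum_le_sum fun t _ => tmono (h1 y t) (hϑ₂pos y t) (by norm_num : 4 ≤ 4)).trans (hΘ y))))
        (fun y z t =>
          (sum_sqrt_mul_le_letters Finset.univ (a := fun s => Hk s z) (c := fun s => ϑ z s ^ 4) (θ := fun s => ϑ₂ z s) (fun s => hHk0 _ _)
            (fun s => pow_nonneg (h0 _ _) _) (fun s => hϑ₂pos _ _) (hhc z)
            ((Finset.sum_le_sum fun s _ => tmono (h1 z s) (hϑ₂pos z s) (by norm_num : 4 ≤ 4)).trans (hΘ z))))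
  have tm20 : ∑ y, ∑ z, ∑ t, ∑ s,
      ((∑ w, (∑ z', D z' w * ∑ u, |A u z'| * K4 x y s u) * (∑ z', D z' w * ∑ u, |A u z'| * K3 z t u) / (1 - lamA) : ℝ)) *
      (ϑ x y * ϑ x z * ϑ x t * ϑ x s * ϑ y z * ϑ y t * ϑ y s * ϑ z t * ϑ z s * ϑ t s) ≤ dθ * αk4m1 * (dθ' * αg1c) / (1 - lamA) := by
    have hw : ∀ y z t s : ι, ϑ x y * ϑ x z * ϑ x t * ϑ x s * ϑ y z * ϑ y t * ϑ y s * ϑ z t * ϑ z s * ϑ t s ≤ ϑ₂ x y * ϑ₂ x s * ϑ₂ y s *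
        (ϑ x z ^ 6 * (ϑ₂ z t)) := fun y z t s =>
      ((prod10_le le_rfl le_rfl ((hm00 x z t)) le_rfl ((hm10 y x z)) (((hm10 y x t).trans (mul_le_mul_of_nonneg_left (hm00 x z t) (h0 _ _))))
              le_rfl le_rfl ((hm10 z x s)) (((hm10 t z s).trans (mul_le_mul_of_nonneg_left (hm10 z x s) (h0 _ _)))) (h0 _ _) (h0 _ _) (h0 _ _)
              (h0 _ _) (h0 _ _) (h0 _ _) (h0 _ _) (h0 _ _) (h0 _ _) (h0 _ _)).trans_eq (by ring)).trans
          (mul_le_mul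
            (mul_le_mul (mul_le_mul (hϑ2k x y 3 (by norm_num)) (hϑ2k x s 3 (by norm_num)) (pow_nonneg (h0 _ _) _) (hϑ₂0 _ _))
              (hϑ2k y s 1 (by norm_num)) (pow_nonneg (h0 _ _) _) (mul_nonneg (hϑ₂0 _ _) (hϑ₂0 _ _)))
            (mul_le_mul (pow_le_pow_right₀ (h1 x z) (by norm_num : 6 ≤ 6)) (hϑ2k z t 4 (by norm_num)) (pow_nonneg (h0 z t) 4)
              (pow_nonneg (h0 _ _) _)) (mul_nonneg (pow_nonneg (h0 _ _) _) (pow_nonneg (h0 z t) 4))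
            (mul_nonneg (mul_nonneg (hϑ₂0 _ _) (hϑ₂0 _ _)) (hϑ₂0 _ _)))
    have h := weighted_two_point_two_families_le' (R := ι × ι) (S := ι × ι) (αm := αk4m1) (g := fun r z' => ∑ u, |A u z'| * K4 x r.1 r.2 u)
        (α := fun r => ϑ₂ x r.1 * ϑ₂ x r.2 * ϑ₂ r.1 r.2) (b := fun q z' => ∑ u, |A u z'| * K3 q.1 q.2 u) (σ := fun w => σ x w)
        (σ₁ := fun z' => σ x z') (σ' := fun q w => σ q.1 w * (ϑ₂ q.1 q.2)) (σ'₁ := fun q z' => σ q.1 z' * (ϑ₂ q.1 q.2))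
        (β := fun q => ϑ x q.1 ^ 6 * (ϑ₂ q.1 q.2)) (fun r z' => hF4 x r.1 r.2 z') (fun r => (hI3 x r.1 r.2)) (fun q z' => hF3 q.1 q.2 z') hD hθnn
        (fun w => hσ0 x w) (fun z' => hσ0 x z') (fun q w => hxI (hϑσ6 x q.1 w) (hϑ₂0 q.1 q.2)) (fun z' w => hσθ x z' w)
        (fun q z' w => hσI (hσθ q.1 z' w) (hϑ₂0 q.1 q.2)) hDθr hdθ hDθc hdθ' (by simpa only [Fintype.sum_prod_type] using hk4m1 x)
        (fun z' => by simpa only [Fintype.sum_prod_type] using hg1c z') hαg1c hlamA1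
    simp only [Fintype.sum_prod_type] at h
    refine (sum4_perm_0312 _).trans_le ?_
    refine le_trans ?_ h
    exact Finset.sum_le_sum fun y _ => Finset.sum_le_sum fun s _ => Finset.sum_le_sum fun z _ => Finset.sum_le_sum fun t _ =>
      mul_le_mul_of_nonneg_left (hw y z t s) (hE (hF4 x y s) (hF3 z t))
  have tm21 : ∑ y, ∑ z, ∑ t, ∑ s,
      ((∑ w, (∑ z', D z' w * ∑ u, |A u z'| * K4 x z t u) * (∑ z', D z' w * ∑ u, |A u z'| * K3 y s u) / (1 - lamA) : ℝ)) *
      (ϑ x y * ϑ x z * ϑ x t * ϑ x s * ϑ y z * ϑ y t * ϑ y s * ϑ z t * ϑ z s * ϑ t s) ≤ dθ * αk4m1 * (dθ' * αg1c) / (1 - lamA) := by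
    have hw : ∀ y z t s : ι, ϑ x y * ϑ x z * ϑ x t * ϑ x s * ϑ y z * ϑ y t * ϑ y s * ϑ z t * ϑ z s * ϑ t s ≤ ϑ₂ x z * ϑ₂ x t * ϑ₂ z t *
        (ϑ x y ^ 6 * (ϑ₂ y s)) := fun y z t s =>
      ((prod10_le le_rfl le_rfl le_rfl ((hm00 x y s)) ((hm10 y x z)) ((hm10 y x t)) le_rfl le_rfl
              (((hm10 z x s).trans (mul_le_mul_of_nonneg_left (hm00 x y s) (h0 _ _))))
              (((hm10 t x s).trans (mul_le_mul_of_nonneg_left (hm00 x y s) (h0 _ _)))) (h0 _ _) (h0 _ _) (h0 _ _) (h0 _ _) (h0 _ _) (h0 _ _)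
              (h0 _ _) (h0 _ _) (h0 _ _) (h0 _ _)).trans_eq (by ring)).trans
          (mul_le_mul
            (mul_le_mul (mul_le_mul (hϑ2k x z 3 (by norm_num)) (hϑ2k x t 3 (by norm_num)) (pow_nonneg (h0 _ _) _) (hϑ₂0 _ _))
              (hϑ2k z t 1 (by norm_num)) (pow_nonneg (h0 _ _) _) (mul_nonneg (hϑ₂0 _ _) (hϑ₂0 _ _)))
            (mul_le_mul (pow_le_pow_right₀ (h1 x y) (by norm_num : 6 ≤ 6)) (hϑ2k y s 4 (by norm_num)) (pow_nonneg (h0 y s) 4)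
              (pow_nonneg (h0 _ _) _)) (mul_nonneg (pow_nonneg (h0 _ _) _) (pow_nonneg (h0 y s) 4))
            (mul_nonneg (mul_nonneg (hϑ₂0 _ _) (hϑ₂0 _ _)) (hϑ₂0 _ _)))
    have h := weighted_two_point_two_families_le' (R := ι × ι) (S := ι × ι) (αm := αk4m1) (g := fun r z' => ∑ u, |A u z'| * K4 x r.1 r.2 u)
        (α := fun r => ϑ₂ x r.1 * ϑ₂ x r.2 * ϑ₂ r.1 r.2) (b := fun q z' => ∑ u, |A u z'| * K3 q.1 q.2 u) (σ := fun w => σ x w)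
        (σ₁ := fun z' => σ x z') (σ' := fun q w => σ q.1 w * (ϑ₂ q.1 q.2)) (σ'₁ := fun q z' => σ q.1 z' * (ϑ₂ q.1 q.2))
        (β := fun q => ϑ x q.1 ^ 6 * (ϑ₂ q.1 q.2)) (fun r z' => hF4 x r.1 r.2 z') (fun r => (hI3 x r.1 r.2)) (fun q z' => hF3 q.1 q.2 z') hD hθnn
        (fun w => hσ0 x w) (fun z' => hσ0 x z') (fun q w => hxI (hϑσ6 x q.1 w) (hϑ₂0 q.1 q.2)) (fun z' w => hσθ x z' w)
        (fun q z' w => hσI (hσθ q.1 z' w) (hϑ₂0 q.1 q.2)) hDθr hdθ hDθc hdθ' (by simpa only [Fintype.sum_prod_type] using hk4m1 x)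
        (fun z' => by simpa only [Fintype.sum_prod_type] using hg1c z') hαg1c hlamA1
    simp only [Fintype.sum_prod_type] at h
    refine (sum4_perm_1203 _).trans_le ?_
    refine le_trans ?_ h
    exact Finset.sum_le_sum fun z _ => Finset.sum_le_sum fun t _ => Finset.sum_le_sum fun y _ => Finset.sum_le_sum fun s _ =>
      mul_le_mul_of_nonneg_left (hw y z t s) (hE (hF4 x z t) (hF3 y s))
  have tm22 : ∑ y, ∑ z, ∑ t, ∑ s, ((Real.sqrt (4 * Hk s y * Hk t z * Real.sqrt (sV) * C3h) / Real.sqrt (ρ x y * ρ x z) : ℝ)) *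
      (ϑ x y * ϑ x z * ϑ x t * ϑ x s * ϑ y z * ϑ y t * ϑ y s * ϑ z t * ϑ z s * ϑ t s) ≤ Real.sqrt (4 * Real.sqrt (sV) * C3h) *
      (G * (G * (Real.sqrt (hcϑ * Θ8) * Real.sqrt (hcϑ * Θ8)))) := by
    have hw : ∀ y z t s : ι, ϑ x y * ϑ x z * ϑ x t * ϑ x s * ϑ y z * ϑ y t * ϑ y s * ϑ z t * ϑ z s * ϑ t s ≤ ϑ x y ^ 6 * ϑ x z ^ 6 * ϑ y s ^ 4 * ϑ
        z t ^ 4 := fun y z t s =>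
      (prod10_le le_rfl le_rfl ((hm00 x z t)) ((hm00 x y s)) ((hm10 y x z))
            (((hm10 y x t).trans (mul_le_mul_of_nonneg_left (hm00 x z t) (h0 _ _)))) le_rfl le_rfl
            (((hm10 z x s).trans (mul_le_mul_of_nonneg_left (hm00 x y s) (h0 _ _))))
            (((hm10 t z s).trans (mul_le_mul_of_nonneg_left ((hm10 z x s).trans (mul_le_mul_of_nonneg_left (hm00 x y s) (h0 _ _))) (h0 _ _))))
            (h0 _ _) (h0 _ _) (h0 _ _) (h0 _ _) (h0 _ _) (h0 _ _) (h0 _ _) (h0 _ _) (h0 _ _) (h0 _ _)).trans_eq (by ring)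
    refine (sum4_perm_0132 _).trans_le ?_
    have hKK0 : 0 ≤ Real.sqrt (4 * Real.sqrt (sV) * C3h) := (Real.sqrt_nonneg _)
    have hpw : ∀ y z t s : ι, ((Real.sqrt (4 * Hk s y * Hk t z * Real.sqrt (sV) * C3h) / Real.sqrt (ρ x y * ρ x z) : ℝ)) *
        (ϑ x y * ϑ x z * ϑ x t * ϑ x s * ϑ y z * ϑ y t * ϑ y s * ϑ z t * ϑ z s * ϑ t s) ≤ Real.sqrt (4 * Real.sqrt (sV) * C3h) *
        (ϑ x y ^ 6 / Real.sqrt (ρ x y) * ((ϑ x z ^ 6 / Real.sqrt (ρ x z)) * ((Real.sqrt (Hk s y) * ϑ y s ^ 4) * (Real.sqrt (Hk t z) * ϑ z t ^ 4))))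
        := fun y z t s =>
      (mul_le_mul_of_nonneg_left (hw y z t s) (div_nonneg (Real.sqrt_nonneg _) (Real.sqrt_nonneg _))).trans_eq
          (by rw [sqrt_split4 (hHk0 s y) (hHk0 t z), Real.sqrt_mul (hρ0 x y).le]; ring)
    refine le_trans
        (Finset.sum_le_sum fun y _ => Finset.sum_le_sum fun z _ => Finset.sum_le_sum fun s _ => Finset.sum_le_sum fun t _ => hpw y z t s) ?_
    exact sum4_le (K := Real.sqrt (4 * Real.sqrt (sV) * C3h)) (a := fun y => ϑ x y ^ 6 / Real.sqrt (ρ x y))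
        (b := fun y z => ϑ x z ^ 6 / Real.sqrt (ρ x z)) (c := fun y z s => Real.sqrt (Hk s y) * ϑ y s ^ 4)
        (d := fun y z s t => Real.sqrt (Hk t z) * ϑ z t ^ 4) hKK0 (fun y => (div_nonneg (pow_nonneg (h0 _ _) _) (Real.sqrt_nonneg _)))
        (fun y z => (div_nonneg (pow_nonneg (h0 _ _) _) (Real.sqrt_nonneg _)))
        (fun y z s => (mul_nonneg (Real.sqrt_nonneg _) (pow_nonneg (h0 _ _) _))) hG0 (Real.sqrt_nonneg _) (Real.sqrt_nonneg _)
        ((Finset.sum_le_sum fun y _ => rmono (h1 x y) (hρ0 x y) (by norm_num : 6 ≤ 6)).trans (hG x))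
        (fun y => ((Finset.sum_le_sum fun z _ => rmono (h1 x z) (hρ0 x z) (by norm_num : 6 ≤ 6)).trans (hG x)))
        (fun y z =>
          (sum_sqrt_mul_le_letters Finset.univ (a := fun s => Hk s y) (c := fun s => ϑ y s ^ 4) (θ := fun s => ϑ₂ y s) (fun s => hHk0 _ _)
            (fun s => pow_nonneg (h0 _ _) _) (fun s => hϑ₂pos _ _) (hhc y)
            ((Finset.sum_le_sum fun s _ => tmono (h1 y s) (hϑ₂pos y s) (by norm_num : 4 ≤ 4)).trans (hΘ y))))
        (fun y z s =>
          (sum_sqrt_mul_le_letters Finset.univ (a := fun t => Hk t z) (c := fun t => ϑ z t ^ 4) (θ := fun t => ϑ₂ z t) (fun t => hHk0 _ _)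
            (fun t => pow_nonneg (h0 _ _) _) (fun t => hϑ₂pos _ _) (hhc z)
            ((Finset.sum_le_sum fun t _ => tmono (h1 z t) (hϑ₂pos z t) (by norm_num : 4 ≤ 4)).trans (hΘ z))))
  have tm23 : ∑ y, ∑ z, ∑ t, ∑ s, ((Real.sqrt (2 * K3 y z x * sV * C3k) / Real.sqrt (ρ x t * ρ x s) : ℝ)) *
      (ϑ x y * ϑ x z * ϑ x t * ϑ x s * ϑ y z * ϑ y t * ϑ y s * ϑ z t * ϑ z s * ϑ t s) ≤ Real.sqrt (2 * sV * C3k) *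
      (G * (G * Real.sqrt (k3cϑ * (Θ8 * Θ8)))) := by
    have hw : ∀ y z t s : ι, ϑ x y * ϑ x z * ϑ x t * ϑ x s * ϑ y z * ϑ y t * ϑ y s * ϑ z t * ϑ z s * ϑ t s ≤ ϑ x y ^ 3 * ϑ x z ^ 3 * ϑ x t ^ 4 * ϑ
        x s ^ 4 * ϑ y z ^ 1 := fun y z t s =>
      (prod10_le le_rfl le_rfl le_rfl le_rfl le_rfl ((hm10 y x t)) ((hm10 y x s)) ((hm10 z x t)) ((hm10 z x s)) ((hm10 t x s)) (h0 _ _) (h0 _ _)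
            (h0 _ _) (h0 _ _) (h0 _ _) (h0 _ _) (h0 _ _) (h0 _ _) (h0 _ _) (h0 _ _)).trans_eq (by ring)
    refine (sum4_perm_2301 _).trans_le ?_
    have hKK0 : 0 ≤ Real.sqrt (2 * sV * C3k) := (Real.sqrt_nonneg _)
    have hpw : ∀ y z t s : ι, ((Real.sqrt (2 * K3 y z x * sV * C3k) / Real.sqrt (ρ x t * ρ x s) : ℝ)) *
        (ϑ x y * ϑ x z * ϑ x t * ϑ x s * ϑ y z * ϑ y t * ϑ y s * ϑ z t * ϑ z s * ϑ t s) ≤ Real.sqrt (2 * sV * C3k) *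
        (ϑ x t ^ 4 / Real.sqrt (ρ x t) * ((ϑ x s ^ 4 / Real.sqrt (ρ x s)) * (Real.sqrt (K3 y z x) * (ϑ x y ^ 3 * ϑ x z ^ 3 * ϑ y z ^ 1)))) := fun
        y z t s =>
      (mul_le_mul_of_nonneg_left (hw y z t s) (div_nonneg (Real.sqrt_nonneg _) (Real.sqrt_nonneg _))).trans_eq
          (by rw [sqrt_split3 (hK30 y z x), Real.sqrt_mul (hρ0 x t).le]; ring)
    refine le_trans
        (Finset.sum_le_sum fun t _ => Finset.sum_le_sum fun s _ => Finset.sum_le_sum fun y _ => Finset.sum_le_sum fun z _ => hpw y z t s) ?_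
    exact sum4_le_pair_last (K := Real.sqrt (2 * sV * C3k)) (a := fun t => ϑ x t ^ 4 / Real.sqrt (ρ x t))
        (b := fun t s => ϑ x s ^ 4 / Real.sqrt (ρ x s)) (e := fun t s y z => Real.sqrt (K3 y z x) * (ϑ x y ^ 3 * ϑ x z ^ 3 * ϑ y z ^ 1)) hKK0
        (fun t => (div_nonneg (pow_nonneg (h0 _ _) _) (Real.sqrt_nonneg _)))
        (fun t s => (div_nonneg (pow_nonneg (h0 _ _) _) (Real.sqrt_nonneg _))) hG0 (Real.sqrt_nonneg _)
        ((Finset.sum_le_sum fun t _ => rmono (h1 x t) (hρ0 x t) (by norm_num : 4 ≤ 6)).trans (hG x))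
        (fun t => ((Finset.sum_le_sum fun s _ => rmono (h1 x s) (hρ0 x s) (by norm_num : 4 ≤ 6)).trans (hG x)))
        (fun t s =>
          (sum2_sqrt_mul_le_letters' (a := fun y z => K3 y z x) (c := fun y z => ϑ x y ^ 3 * ϑ x z ^ 3 * ϑ y z ^ 1)
            (θ := fun y z => ϑ₂ x y * ϑ₂ x z * ϑ₂ y z) (fun y z => hK30 _ _ _)
            (fun y z => mul_nonneg (mul_nonneg (pow_nonneg (h0 _ _) _) (pow_nonneg (h0 _ _) _)) (pow_nonneg (h0 _ _) _))
            (fun y z => mul_pos (mul_pos (hϑ₂pos _ _) (hϑ₂pos _ _)) (hϑ₂pos _ _)) (hk3c x)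
            ((Finset.sum_le_sum fun y _ => Finset.sum_le_sum fun z _ => pmono (h1 x y) (h1 x z) (h1 y z) (hϑ₂pos x y) (hϑ₂pos x z) (hϑ₂pos y z)
                (hϑsq y z 1 (by norm_num)) (by norm_num : 3 ≤ 4) (by norm_num : 3 ≤ 4)).trans (geom2 (fun z => tnn x z) (hΘ x) (hΘ x) hT0))))
  have tm24 : ∑ y, ∑ z, ∑ t, ∑ s, ((Real.sqrt (4 * Hk t x * Hk z y * Real.sqrt (sV) * C3h) / Real.sqrt (ρ x y * ρ x s) : ℝ)) *
      (ϑ x y * ϑ x z * ϑ x t * ϑ x s * ϑ y z * ϑ y t * ϑ y s * ϑ z t * ϑ z s * ϑ t s) ≤ Real.sqrt (4 * Real.sqrt (sV) * C3h) *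
      (G * (Real.sqrt (hcϑ * Θ8) * (G * Real.sqrt (hcϑ * Θ8)))) := by
    have hw : ∀ y z t s : ι, ϑ x y * ϑ x z * ϑ x t * ϑ x s * ϑ y z * ϑ y t * ϑ y s * ϑ z t * ϑ z s * ϑ t s ≤ ϑ x y ^ 6 * ϑ x t ^ 4 * ϑ x s ^ 4 * ϑ
        y z ^ 4 := fun y z t s =>
      (prod10_le le_rfl ((hm00 x y z)) le_rfl le_rfl le_rfl ((hm10 y x t)) ((hm10 y x s))
            (((hm10 z y t).trans (mul_le_mul_of_nonneg_left (hm10 y x t) (h0 _ _))))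
            (((hm10 z y s).trans (mul_le_mul_of_nonneg_left (hm10 y x s) (h0 _ _)))) ((hm10 t x s)) (h0 _ _) (h0 _ _) (h0 _ _) (h0 _ _) (h0 _ _)
            (h0 _ _) (h0 _ _) (h0 _ _) (h0 _ _) (h0 _ _)).trans_eq (by ring)
    refine (sum4_perm_0231 _).trans_le ?_
    have hKK0 : 0 ≤ Real.sqrt (4 * Real.sqrt (sV) * C3h) := (Real.sqrt_nonneg _)
    have hpw : ∀ y z t s : ι, ((Real.sqrt (4 * Hk t x * Hk z y * Real.sqrt (sV) * C3h) / Real.sqrt (ρ x y * ρ x s) : ℝ)) *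
        (ϑ x y * ϑ x z * ϑ x t * ϑ x s * ϑ y z * ϑ y t * ϑ y s * ϑ z t * ϑ z s * ϑ t s) ≤ Real.sqrt (4 * Real.sqrt (sV) * C3h) *
        (ϑ x y ^ 6 / Real.sqrt (ρ x y) * ((Real.sqrt (Hk t x) * ϑ x t ^ 4) * ((ϑ x s ^ 4 / Real.sqrt (ρ x s)) * (Real.sqrt (Hk z y) * ϑ y z ^ 4))))
        := fun y z t s =>
      (mul_le_mul_of_nonneg_left (hw y z t s) (div_nonneg (Real.sqrt_nonneg _) (Real.sqrt_nonneg _))).trans_eq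
          (by rw [sqrt_split4 (hHk0 t x) (hHk0 z y), Real.sqrt_mul (hρ0 x y).le]; ring)
    refine le_trans
        (Finset.sum_le_sum fun y _ => Finset.sum_le_sum fun t _ => Finset.sum_le_sum fun s _ => Finset.sum_le_sum fun z _ => hpw y z t s) ?_
    exact sum4_le (K := Real.sqrt (4 * Real.sqrt (sV) * C3h)) (a := fun y => ϑ x y ^ 6 / Real.sqrt (ρ x y))
        (b := fun y t => Real.sqrt (Hk t x) * ϑ x t ^ 4) (c := fun y t s => ϑ x s ^ 4 / Real.sqrt (ρ x s))
        (d := fun y t s z => Real.sqrt (Hk z y) * ϑ y z ^ 4) hKK0 (fun y => (div_nonneg (pow_nonneg (h0 _ _) _) (Real.sqrt_nonneg _)))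
        (fun y t => (mul_nonneg (Real.sqrt_nonneg _) (pow_nonneg (h0 _ _) _)))
        (fun y t s => (div_nonneg (pow_nonneg (h0 _ _) _) (Real.sqrt_nonneg _))) (Real.sqrt_nonneg _) hG0 (Real.sqrt_nonneg _)
        ((Finset.sum_le_sum fun y _ => rmono (h1 x y) (hρ0 x y) (by norm_num : 6 ≤ 6)).trans (hG x))
        (fun y =>
          (sum_sqrt_mul_le_letters Finset.univ (a := fun t => Hk t x) (c := fun t => ϑ x t ^ 4) (θ := fun t => ϑ₂ x t) (fun t => hHk0 _ _)
            (fun t => pow_nonneg (h0 _ _) _) (fun t => hϑ₂pos _ _) (hhc x)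
            ((Finset.sum_le_sum fun t _ => tmono (h1 x t) (hϑ₂pos x t) (by norm_num : 4 ≤ 4)).trans (hΘ x))))
        (fun y t => ((Finset.sum_le_sum fun s _ => rmono (h1 x s) (hρ0 x s) (by norm_num : 4 ≤ 6)).trans (hG x)))
        (fun y t s =>
          (sum_sqrt_mul_le_letters Finset.univ (a := fun z => Hk z y) (c := fun z => ϑ y z ^ 4) (θ := fun z => ϑ₂ y z) (fun z => hHk0 _ _)
            (fun z => pow_nonneg (h0 _ _) _) (fun z => hϑ₂pos _ _) (hhc y)
            ((Finset.sum_le_sum fun z _ => tmono (h1 y z) (hϑ₂pos y z) (by norm_num : 4 ≤ 4)).trans (hΘ y))))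
  simp (config := { maxSteps := 4000000 }) only [add_mul, Finset.sum_add_distrib]
  linarith [tm17, tm18, tm19, tm20, tm21, tm22, tm23, tm24]

/-! ## Toy -/

/-- Toy (a routed load in numbers): carrying four pairs through one edge of weight `2` costs `2⁴ = 16 ≤ 2⁶`. -/
example : (2 : ℝ) ^ 4 ≤ 2 ^ 6 := by norm_num

end Summit.QuantumFields.BalabanUV.T4Continuum.NE7b.SupWeightedFifthOrderLettersOnePart3

end
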